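import Summits.CriticalPhenomena.PercolationContinuityZ3.Theorems.PercNearOneGluingNoHeavyLowerTailIncStarWDOMTwoProngedCore
import HarnessLib

/-!
# Mass comparison implies domination at a two-pronged root, part 1: arithmetic core (Sahi programme, prover prim-sahi-p2 gen 35)

Support file (`--supports stmt-CriticalPhenomena-4575`).  No definitions, no named facts, no sorries; standard axioms.
Memo `run/shared/lean/prim/prim-sahi/FROM-prim-sahi-p2-gen35-FIBRE-TRANSPORT.md` §2, `prim-sahi-p2/PROOF-E3.md` §45.

**`twoPronged_transport`.**  Let `s, i, j` be distinct, the root `s` carrying weight `0` on every non-loop pair other than `s(s,i)`, `s(s,j)`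
(the rest of the graph arbitrary), `B_v = {s ↔ v}`.  If nonnegative weights `cp, ωi, ωj` satisfy the single MASS inequality
`ωi·P(B_i ∖ B_j) + ωj·P(B_j ∖ B_i) ≤ cp·P(B_i ∩ B_j)`, then the same inequality holds after intersecting every event with
`A = {ω | C_s(ω) ∈ 𝒜}` for ANY up-closed family `𝒜` of vertex sets.  This is the two-pronged W-domination theorem of gen 34
(`wdom_twoPronged`, the instance `cp = 2 − q_i − q_j − EW`, `ωi = q_j + EW`, `ωj = q_i + EW`) with the graph's own constants replaced by
free weights: the proof (`twoPronged_transport_core`) is the same budget certificate, whose only input beyond Harris under the pinned laws is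
the mass inequality.  Read on the law of `C_s` conditioned on the cluster `L` of `s` avoiding `{i,j}` (root `L`, gates `a_L, b_L`), it is the
FIBRE THEOREM of the memo: every fibre with `β_L + (1−a_L)(1−b_L)·EW ≥ 0` is self-sufficient for W-domination.
-/

noncomputable section

namespace Summit.CriticalPhenomena.PercolationContinuityZ3.Theorems

namespace IncStar

open MeasureTheory Set Literature.Probability.Percolation Literature.Probability.LatticeModels EdgeInduction
open scoped Classical

variable {n : ℕ}

/-- The real-arithmetic core of `twoPronged_transport`: the budget certificate of `wdom_twoPronged_core` with FREE nonnegative weights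
`cp, Di, Dj` in place of the graph's own constants; the only hypothesis tying them to the gate/link probabilities `a, b, u` is the mass
inequality `(1−u)(Di+Dj) ≤ cp·((a+b−ab)u + ab(1−u))`. [this work] -/
theorem twoPronged_transport_core (a b u A X Y M cp Di Dj : ℝ)
    (ha0 : 0 ≤ a) (hb0 : 0 ≤ b) (hb1 : b ≤ 1) (hu1 : u ≤ 1)
    (hcp0 : 0 ≤ cp) (hDi0 : 0 ≤ Di) (hDj0 : 0 ≤ Dj)
    (hA : 0 ≤ A) (hX : 0 ≤ X) (hY : 0 ≤ Y)
    (hH1 : u * X ≤ (1 - u) * A) (hH2 : u * Y ≤ (1 - u) * A) (hM1 : X ≤ M) (hM2 : Y ≤ M)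
    (hmass : (1 - u) * (Di + Dj) ≤ cp * (a + b - a * b) * u + a * b * cp * (1 - u)) :
    0 ≤ cp * (a + b - a * b) * A + a * b * cp * M - Di * X - Dj * Y := by
  have hab1 : 0 ≤ a + b - a * b := by have : 0 ≤ a * (1 - b) := mul_nonneg ha0 (by linarith); linarith
  obtain ⟨S, hS⟩ : ∃ S : ℝ, S = cp * (a + b - a * b) * u + a * b * cp * (1 - u) := ⟨_, rfl⟩
  obtain ⟨R, hR⟩ : ∃ R : ℝ, R = S - (1 - u) * (Di + Dj) := ⟨_, rfl⟩
  have hR0 : 0 ≤ R := by rw [hR, hS]; linarith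
  have hS0 : 0 ≤ S - (1 - u) * Di := by
    have : S - (1 - u) * Di = R + (1 - u) * Dj := by rw [hR]; ring
    rw [this]; exact add_nonneg hR0 (mul_nonneg (by linarith) hDj0)
  have SS : 0 ≤ S := by linarith [hS0, mul_nonneg (by linarith : (0:ℝ) ≤ 1 - u) hDi0]
  obtain ⟨T, hT⟩ : ∃ T : ℝ, T = cp * (a + b - a * b) * A + a * b * cp * M - Di * X - Dj * Y := ⟨_, rfl⟩
  rw [← hT]
  -- the certificate identity
  have key : S * (1 - u) * T
      = cp * (a + b - a * b) * (((1 - u) * Di) * ((1 - u) * A - u * X) + (S - (1 - u) * Di) * ((1 - u) * A - u * Y))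
        + a * b * cp * (1 - u) * (((1 - u) * Di) * (M - X) + (S - (1 - u) * Di) * (M - Y))
        + S * R * Y := by
    rw [hR, hT, hS]
    ring
  have hRHS : 0 ≤ S * (1 - u) * T := by
    rw [key]
    have t1 : 0 ≤ ((1 - u) * Di) * ((1 - u) * A - u * X) := mul_nonneg (mul_nonneg (by linarith) hDi0) (by linarith)
    have t2 : 0 ≤ (S - (1 - u) * Di) * ((1 - u) * A - u * Y) := mul_nonneg hS0 (by linarith)
    have t3 : 0 ≤ ((1 - u) * Di) * (M - X) := mul_nonneg (mul_nonneg (by linarith) hDi0) (by linarith)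
    have t4 : 0 ≤ (S - (1 - u) * Di) * (M - Y) := mul_nonneg hS0 (by linarith)
    have c1 : 0 ≤ cp * (a + b - a * b) := mul_nonneg hcp0 hab1
    have c2 : 0 ≤ a * b * cp * (1 - u) := mul_nonneg (mul_nonneg (mul_nonneg ha0 hb0) hcp0) (by linarith)
    have t5 : 0 ≤ S * R * Y := mul_nonneg (mul_nonneg SS hR0) hY
    have := add_nonneg (add_nonneg (mul_nonneg c1 (add_nonneg t1 t2)) (mul_nonneg c2 (add_nonneg t3 t4))) t5
    linarith
  have hTform : ∀ (hX0 : Di * X = 0) (hY0 : Dj * Y = 0), 0 ≤ T := by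
    intro hX0 hY0
    rw [hT, hX0, hY0, sub_zero, sub_zero]
    have c1 : 0 ≤ cp * (a + b - a * b) := mul_nonneg hcp0 hab1
    have : 0 ≤ a * b * cp * M := mul_nonneg (mul_nonneg (mul_nonneg ha0 hb0) hcp0) (le_trans hX hM1)
    exact add_nonneg (mul_nonneg c1 hA) this
  -- conclude: either S(1-u) > 0, or a degenerate case where T ≥ 0 directly
  by_cases hu : u = 1
  · have hX0 : X = 0 := by
      have h := hH1; rw [hu] at h; norm_num at h; linarith
    have hY0 : Y = 0 := by
      have h := hH2; rw [hu] at h; norm_num at h; linarith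
    exact hTform (by rw [hX0, mul_zero]) (by rw [hY0, mul_zero])
  have hu' : 0 < 1 - u := by
    rcases lt_or_eq_of_le hu1 with h | h
    · linarith
    · exact absurd h hu
  by_cases hSpos : 0 < S
  · have hpos : 0 < S * (1 - u) := mul_pos hSpos hu'
    by_contra hneg
    have hneg' : T < 0 := lt_of_not_ge hneg
    have : S * (1 - u) * T < 0 := mul_neg_of_pos_of_neg hpos hneg'
    linarith
  · have hS00 : S = 0 := le_antisymm (not_lt.1 hSpos) SS
    have hprod : (1 - u) * (Di + Dj) ≤ 0 := by
      have h := hmass; rw [← hS, hS00] at h; exact h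
    have hDsum : Di + Dj ≤ 0 := by
      by_contra hc
      have hc' : 0 < Di + Dj := lt_of_not_ge hc
      have : 0 < (1 - u) * (Di + Dj) := mul_pos hu' hc'
      linarith
    have hDi00 : Di = 0 := by linarith
    have hDj00 : Dj = 0 := by linarith
    exact hTform (by rw [hDi00, zero_mul]) (by rw [hDj00, zero_mul])


end IncStar
end Summit.CriticalPhenomena.PercolationContinuityZ3.Theorems
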